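import Literature.NumberTheory.DiophantineGeometry.GenEllCuspTransferPower
import Literature.NumberTheory.DiophantineGeometry.GenEllCuspTransferConj
import Literature.NumberTheory.DiophantineGeometry.GenEllCuspTransferCheb
import Literature.NumberTheory.DiophantineGeometry.GenEllThm21Finite
import Literature.NumberTheory.DiophantineGeometry.RationalFunctionHeight
import HarnessLib

/-!
# [GenEll] Thm. 2.1, proof: the transfer lemma in the shape consumed by the menu/covering argument

S. Mochizuki, *Arithmetic elliptic curves in general position*, Math. J. Okayama Univ. 52 (2010)
[cite: MochizukiGenEll2010, Thm 2.1 pp.11–13]. Adapter between the transfer lemma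
(`GenEllCuspTransfer.vojtaIneq_transfer`: Vojta with `ε'` on `T` ⟹ Vojta with
`(1+ε')/(n − (1+ε')·deg B) − 1` on the `γ`-preimage of `T`) and the covering argument of the cell's
ℙ¹-route for GenEllTwo (abc-iut-S6's `GenEllMenuSpine.vojtaP1Deg_of_menu`, hypothesis `hmech`):

* `vojtaIneq_mono_eps` — Vojta with `ε₁` implies Vojta with any `ε₂ ≥ ε₁` (`log-diff + log-cond ≥ 0`);
* `vojtaIneq_preimageSet_of_forall` — for a certificated `γ` with `deg B ≤ n − 1`: if Vojta holds on `T`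
  for EVERY `ε' > 0`, then Vojta holds on `γ.preimageSet T` for every `ε > 0` (choose
  `ε' = ε/(2(deg B + 1)(1+ε))`);
* `map_eval` — `σ(γ(x)) = γ(σ(x))` for ring homomorphisms (`γ` has integer coefficients);
* `vojtaIneq_conj_of_transfer` — **the `hmech` shape**: from Vojta (all `ε > 0`, degree `≤ d`) on the
  points all of whose conjugates (complex, and `p`-adic for one prime `p`) satisfy predicates `A`, `B`,
  Vojta (all `ε > 0`, degree `≤ d`) on the points all of whose conjugates `z` are poles of `γ` or have
  `A(γ(z))` (resp. `B(γ(z))`) — via `GenEllImagePoints.imageAt_forall_embedding`;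
* `exists_hlow_of_isCoprime` — the height lower bound `n·ht(x) ≤ ht(γ(x)) + O(1)` for every `γ = f/g`
  with `f, g` coprime over `ℚ` of exact degree `n` (abc-iut-w5-d078's `RationalFunctionHeight`,
  Silverman AEC VIII.5.6), i.e. the hypothesis `hlow` of the transfer lemma, discharged generically;
  `exists_hlow_cheb` — in particular for the Chebyshev family;
* `vojtaIneq_conj_pow` / `_oneSubPow` / `_powDivPow` / `_cheb` — the `hmech` shape for the six menu
  families' building blocks (power maps, their two `S₃`-conjugates, Chebyshev), hypothesis-free.

Classical; abc-iut cell, route item GenEllTwo (stmt-ABC-19679), work package W2; nothing here bears on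
[IUTchIII] Cor. 3.12.
-/

noncomputable section

open NumberField Height Polynomial

namespace Literature.NumberTheory.DiophantineGeometry.GenEll

/-- **Vojta is monotone in `ε`**: `ht ≲ (1+ε₁)(log-diff + log-cond)` implies the same with any
`ε₂ ≥ ε₁`, since `log-diff + log-cond ≥ 0`. [cite: MochizukiGenEll2010, Thm 2.1 p.11] -/
theorem vojtaIneq_mono_eps {S : Set NFPoint} {d : ℕ} {ε₁ ε₂ : ℝ} (h12 : ε₁ ≤ ε₂)
    (h : VojtaIneq S d ε₁) : VojtaIneq S d ε₂ := by
  obtain ⟨C, hC⟩ := h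
  refine ⟨C, fun P hP => ?_⟩
  have h1 := hC P hP
  have hX : 0 ≤ P.logDiff + P.logCond := add_nonneg P.logDiff_nonneg P.logCond_nonneg
  have h2 : (1 + ε₁) * (P.logDiff + P.logCond) ≤ (1 + ε₂) * (P.logDiff + P.logCond) :=
    mul_le_mul_of_nonneg_right (by linarith) hX
  simp only at h1 ⊢
  linarith

namespace P1FiniteMap

/-- `σ(γ(x)) = γ(σ(x))` for a ring homomorphism `σ` of fields (`γ = f/g` has integer coefficients):
the conjugates of `γ(x)` are the `γ(σ x)` ("the set of `[F:ℚ]` points … determined by `x`", [GenEll]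
Ex. 1.3 (ii) p. 6, is permuted by `γ`). [cite: MochizukiGenEll2010, Ex 1.3 (ii) p.6] -/
theorem map_eval (φ : P1FiniteMap) {F L : Type*} [Field F] [Field L] (σ : F →+* L) (x : F) :
    σ (φ.eval x) = φ.eval (σ x) := by
  simp only [eval, map_div₀]
  congr 1
  · exact (aeval_algHom_apply σ.toIntAlgHom x φ.num).symm
  · exact (aeval_algHom_apply σ.toIntAlgHom x φ.den).symm

/-- `σ(g(x)) = g(σ(x))`: the conjugates of a pole of `γ` are poles. [cite: MochizukiGenEll2010, Ex 1.3 (ii) p.6] -/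
theorem map_aeval_den (φ : P1FiniteMap) {F L : Type*} [Field F] [Field L] (σ : F →+* L) (x : F) :
    σ (aeval x φ.den) = aeval (σ x) φ.den :=
  (aeval_algHom_apply σ.toIntAlgHom x φ.den).symm

end P1FiniteMap

namespace NFPoint

variable {φ : P1FiniteMap} (R : ReducedPullback φ)

/-- **Transfer, all-`ε` form**: for a certificated `γ` with `deg B + 1 ≤ n` and the height lower bound
`hlow`, Vojta on `T` for every `ε' > 0` (degree `≤ d`) implies Vojta on the `γ`-preimage of `T` for every
`ε > 0` (degree `≤ d`): take `ε' := ε/(2(deg B + 1)(1 + ε))` in `vojtaIneq_transfer` and enlarge the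
resulting `(1+ε')/(n − (1+ε')deg B) − 1 ≤ ε`. [cite: MochizukiGenEll2010, Thm 2.1 p.13] -/
theorem vojtaIneq_preimageSet_of_forall (hB : R.B.deg + 1 ≤ φ.deg) {Cφ : ℝ}
    (hlow : ∀ P : NFPoint, P.OffDiv φ.pullbackCusps →
      (φ.deg : ℝ) * P.ht ≤ (P.degree : ℝ)⁻¹ * logHeight₁ (φ.eval P.x) + Cφ)
    {T : Set NFPoint} {d : ℕ} (hT : ∀ ε : ℝ, 0 < ε → VojtaIneq T d ε) :
    ∀ ε : ℝ, 0 < ε → VojtaIneq (φ.preimageSet T) d ε := by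
  intro ε hε
  set N : ℝ := (R.B.deg : ℝ) with hNdef
  set n : ℝ := (φ.deg : ℝ) with hndef
  have hNn : N + 1 ≤ n := by
    have h := hB
    rw [hNdef, hndef]
    exact_mod_cast h
  have hN0 : 0 ≤ N := Nat.cast_nonneg _
  have hK : 0 < 2 * (N + 1) * (1 + ε) := by positivity
  set ε' : ℝ := ε / (2 * (N + 1) * (1 + ε)) with hε'def
  have hε'pos : 0 < ε' := div_pos hε hK
  have hkey : ε' * (2 * (N + 1) * (1 + ε)) = ε := div_mul_cancel₀ _ hK.ne'
  -- `ε'·N ≤ 1/2`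
  have hε'N : ε' * N ≤ 1 / 2 := by
    have : ε' * N * (2 * (1 + ε)) ≤ ε' * (2 * (N + 1) * (1 + ε)) := by nlinarith
    rw [hkey] at this
    nlinarith
  have ha : (1 + ε') * N < n := by nlinarith
  have ha' : (1 + ε') * (R.B.deg : ℝ) < (φ.deg : ℝ) := ha
  have h := vojtaIneq_transfer R hlow hε'pos.le ha' (hT ε' hε'pos)
  refine vojtaIneq_mono_eps ?_ h
  change (1 + ε') / (n - (1 + ε') * N) - 1 ≤ ε
  have hD : 0 < n - (1 + ε') * N := by linarith
  rw [sub_le_iff_le_add, div_le_iff₀ hD]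
  -- `ε'·(1 + (1+ε)N) ≤ ε'·(1+ε)(N+1) = ε/2`
  have h4 : ε' * (1 + (1 + ε) * N) ≤ ε / 2 := by
    have : ε' * (1 + (1 + ε) * N) ≤ ε' * ((1 + ε) * (N + 1)) :=
      mul_le_mul_of_nonneg_left (by nlinarith) hε'pos.le
    nlinarith
  have h5 : 0 ≤ (n - (N + 1)) * (1 + ε) := mul_nonneg (by linarith) (by linarith)
  nlinarith

/-- **THE TRANSFER LEMMA IN `hmech` SHAPE** (the cell's ℙ¹-route, covering step): let `γ` be
certificated (`deg B + 1 ≤ n`, height lower bound `hlow`), `A` a predicate on `ℂ` and `B` a predicate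
on `Q̄_p`. If Vojta holds in degree `≤ d`, for every `ε > 0`, on the points ALL of whose complex
conjugates satisfy `A` and all of whose `p`-adic conjugates satisfy `B`, then Vojta holds in degree
`≤ d`, for every `ε > 0`, on the points all of whose conjugates `z` either are poles of `γ` (`g(z) = 0`)
or satisfy `A(γ(z))`, resp. `B(γ(z))`. (The `γ`-image of such a point, re-presented over `ℚ(γ(x))`, has
all ITS conjugates among the `γ(σ x)`, `GenEllImagePoints.imageAt_forall_embedding`.)
[cite: MochizukiGenEll2010, Thm 2.1 p.13] -/
theorem vojtaIneq_conj_of_transfer (hB : R.B.deg + 1 ≤ φ.deg) {Cφ : ℝ}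
    (hlow : ∀ P : NFPoint, P.OffDiv φ.pullbackCusps →
      (φ.deg : ℝ) * P.ht ≤ (P.degree : ℝ)⁻¹ * logHeight₁ (φ.eval P.x) + Cφ)
    {A : ℂ → Prop} {p : ℕ} [Fact p.Prime] {B : PadicAlgCl p → Prop} {d : ℕ}
    (hT : ∀ ε : ℝ, 0 < ε → VojtaIneq
      {Q : NFPoint | (∀ τ : Q.F →+* ℂ, A (τ Q.x)) ∧ ∀ τ : Q.F →+* PadicAlgCl p, B (τ Q.x)} d ε) :
    ∀ ε : ℝ, 0 < ε → VojtaIneq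
      {P : NFPoint | (∀ σ : P.F →+* ℂ, aeval (σ P.x) φ.den = 0 ∨ A (φ.eval (σ P.x))) ∧
        ∀ σ : P.F →+* PadicAlgCl p, aeval (σ P.x) φ.den = 0 ∨ B (φ.eval (σ P.x))} d ε := by
  intro ε hε
  refine vojtaIneq_mono (vojtaIneq_preimageSet_of_forall R hB hlow hT ε hε) ?_
  rintro P ⟨hA, hB'⟩ hoff
  have hg : aeval P.x φ.den ≠ 0 := (P.mapsUnder_imageAt hoff).den_ne_zero
  refine ⟨P.imageAt_forall_embedding (φ.eval P.x) (Q := A) fun σ => ?_,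
    P.imageAt_forall_embedding_padic (φ.eval P.x) p (Q := B) fun σ => ?_⟩
  · rcases hA σ with h0 | h1
    · have h0' : σ (aeval P.x φ.den) = 0 := by
        rw [φ.map_aeval_den σ]; convert h0 using 2
      exact absurd ((map_eq_zero σ).mp h0') hg
    · rw [← φ.map_eval σ] at h1; convert h1 using 2
  · rcases hB' σ with h0 | h1
    · -- (the `ℤ`-algebra structure of `Q̄_p` used by `aeval` is not the default one: go through `eval₂`)
      have e : σ (aeval P.x φ.den) = aeval (σ P.x) φ.den := by
        rw [aeval_def, aeval_def, hom_eval₂]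
        congr 1
        exact Subsingleton.elim _ _
      rw [← e, map_eq_zero] at h0
      exact absurd h0 hg
    · rw [← φ.map_eval σ] at h1; convert h1 using 2

/-- **The height lower bound `hlow` for every genuine degree-`n` map** `γ = f/g` (`f, g` coprime in
`ℚ[t]`, `max(deg f, deg g) = n`): `n·ht(x) ≤ ht(γ(x)) + C` uniformly over all presented points off
`γ⁻¹(C)` — Silverman AEC VIII.5.6 / [GenEll] Prop. 1.4 (i), (iii) for `ℙ¹`, via abc-iut-w5-d078's
`exists_mul_logHeight₁_le_add_finrank`. [cite: SilvermanAEC2009, Thm VIII.5.6] -/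
theorem exists_hlow_of_isCoprime (φ : P1FiniteMap)
    (hcop : IsCoprime (φ.num.map (Int.castRingHom ℚ)) (φ.den.map (Int.castRingHom ℚ)))
    (hn : φ.num.natDegree = φ.deg ∨ φ.den.natDegree = φ.deg) :
    ∃ C : ℝ, ∀ P : NFPoint, P.OffDiv φ.pullbackCusps →
      (φ.deg : ℝ) * P.ht ≤ (P.degree : ℝ)⁻¹ * logHeight₁ (φ.eval P.x) + C := by
  have hinj : Function.Injective (Int.castRingHom ℚ) := (Int.castRingHom ℚ).injective_int
  have hp : (φ.num.map (Int.castRingHom ℚ)).natDegree ≤ φ.deg := by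
    rw [natDegree_map_eq_of_injective hinj]; exact φ.natDegree_num_le
  have hq : (φ.den.map (Int.castRingHom ℚ)).natDegree ≤ φ.deg := by
    rw [natDegree_map_eq_of_injective hinj]; exact φ.natDegree_den_le
  have hn' : (φ.num.map (Int.castRingHom ℚ)).natDegree = φ.deg ∨
      (φ.den.map (Int.castRingHom ℚ)).natDegree = φ.deg := by
    rwa [natDegree_map_eq_of_injective hinj, natDegree_map_eq_of_injective hinj]
  obtain ⟨C, hC⟩ := exists_mul_logHeight₁_le_add_finrank (k := ℚ) hcop hp hq hn'
  refine ⟨C, hlow_of_relative (φ := φ) fun K _ _ x _ => ?_⟩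
  have h := (hC K x).1
  have e : ∀ f : ℤ[X], aeval x (f.map (Int.castRingHom ℚ)) = aeval x f := fun f => by
    rw [← algebraMap_int_eq, aeval_map_algebraMap]
  rw [e, e] at h
  exact h


/-! ## The menu families, hypothesis-free -/

/-- The height lower bound for the Chebyshev map `γ_p` (`p = 2m+1`): `p·ht(x) ≤ ht(γ_p(x)) + C`
(numerator and the constant denominator `4` are coprime; exact degree `p`, `natDegree_cheb_num`).
[cite: SilvermanAEC2009, Thm VIII.5.6] -/
theorem exists_hlow_cheb (m : ℕ) : ∃ C : ℝ, ∀ P : NFPoint,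
    P.OffDiv (P1FiniteMap.cheb m).pullbackCusps →
      ((P1FiniteMap.cheb m).deg : ℝ) * P.ht ≤
        (P.degree : ℝ)⁻¹ * logHeight₁ ((P1FiniteMap.cheb m).eval P.x) + C := by
  refine exists_hlow_of_isCoprime (P1FiniteMap.cheb m) ?_ (Or.inl (P1FiniteMap.natDegree_cheb_num m))
  have h4 : (P1FiniteMap.cheb m).den.map (Int.castRingHom ℚ) = Polynomial.C (4 : ℚ) := by
    change (4 : ℤ[X]).map (Int.castRingHom ℚ) = Polynomial.C 4
    rw [Polynomial.map_ofNat]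
    rfl
  rw [h4]
  refine ⟨0, Polynomial.C (4⁻¹ : ℚ), ?_⟩
  rw [zero_mul, zero_add, ← map_mul, inv_mul_cancel₀ (by norm_num : (4 : ℚ) ≠ 0), map_one]

variable {A : ℂ → Prop} {p : ℕ} [Fact p.Prime] {B : PadicAlgCl p → Prop} {d : ℕ}

/-- `hmech` for the power map `x ↦ x^n` (`n ≥ 1`; no poles). [cite: MochizukiGenEll2010, Thm 2.1 p.13] -/
theorem vojtaIneq_conj_pow {n : ℕ} (hn : 1 ≤ n)
    (hT : ∀ ε : ℝ, 0 < ε → VojtaIneq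
      {Q : NFPoint | (∀ τ : Q.F →+* ℂ, A (τ Q.x)) ∧ ∀ τ : Q.F →+* PadicAlgCl p, B (τ Q.x)} d ε) :
    ∀ ε : ℝ, 0 < ε → VojtaIneq
      {P : NFPoint | (∀ σ : P.F →+* ℂ, aeval (σ P.x) (P1FiniteMap.pow n).den = 0 ∨
          A ((P1FiniteMap.pow n).eval (σ P.x))) ∧
        ∀ σ : P.F →+* PadicAlgCl p, aeval (σ P.x) (P1FiniteMap.pow n).den = 0 ∨
          B ((P1FiniteMap.pow n).eval (σ P.x))} d ε :=
  vojtaIneq_conj_of_transfer (P1FiniteMap.powReduced n hn)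
    (by rw [P1FiniteMap.powReduced_B_deg]; change n - 1 + 1 ≤ n; omega) (hlow_pow n) hT

/-- `hmech` for `x ↦ 1 − (1−x)^n` (`n ≥ 1`; no poles). [cite: MochizukiGenEll2010, Thm 2.1 p.13] -/
theorem vojtaIneq_conj_oneSubPow {n : ℕ} (hn : 1 ≤ n)
    (hT : ∀ ε : ℝ, 0 < ε → VojtaIneq
      {Q : NFPoint | (∀ τ : Q.F →+* ℂ, A (τ Q.x)) ∧ ∀ τ : Q.F →+* PadicAlgCl p, B (τ Q.x)} d ε) :
    ∀ ε : ℝ, 0 < ε → VojtaIneq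
      {P : NFPoint | (∀ σ : P.F →+* ℂ, aeval (σ P.x) (P1FiniteMap.oneSubPow n).den = 0 ∨
          A ((P1FiniteMap.oneSubPow n).eval (σ P.x))) ∧
        ∀ σ : P.F →+* PadicAlgCl p, aeval (σ P.x) (P1FiniteMap.oneSubPow n).den = 0 ∨
          B ((P1FiniteMap.oneSubPow n).eval (σ P.x))} d ε :=
  vojtaIneq_conj_of_transfer (P1FiniteMap.oneSubPowReduced n hn)
    (by rw [P1FiniteMap.oneSubPowReduced_B_deg]; change n - 1 + 1 ≤ n; omega) (hlow_oneSubPow n) hT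

/-- `hmech` for `x ↦ x^n/(x^n − (x−1)^n)` (`n ≥ 1`; poles at `x/(x−1) ∈ μ_n ∖ {1}`).
[cite: MochizukiGenEll2010, Thm 2.1 p.13] -/
theorem vojtaIneq_conj_powDivPow {n : ℕ} (hn : 1 ≤ n)
    (hT : ∀ ε : ℝ, 0 < ε → VojtaIneq
      {Q : NFPoint | (∀ τ : Q.F →+* ℂ, A (τ Q.x)) ∧ ∀ τ : Q.F →+* PadicAlgCl p, B (τ Q.x)} d ε) :
    ∀ ε : ℝ, 0 < ε → VojtaIneq
      {P : NFPoint | (∀ σ : P.F →+* ℂ, aeval (σ P.x) (P1FiniteMap.powDivPow n).den = 0 ∨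
          A ((P1FiniteMap.powDivPow n).eval (σ P.x))) ∧
        ∀ σ : P.F →+* PadicAlgCl p, aeval (σ P.x) (P1FiniteMap.powDivPow n).den = 0 ∨
          B ((P1FiniteMap.powDivPow n).eval (σ P.x))} d ε :=
  vojtaIneq_conj_of_transfer (P1FiniteMap.powDivPowReduced n hn)
    (by rw [P1FiniteMap.powDivPowReduced_B_deg]; change n - 1 + 1 ≤ n; omega) (hlow_powDivPow n) hT

/-- `hmech` for the Chebyshev map `γ_p`, `p = 2m + 1 ≥ 3` (no poles). [cite: MochizukiGenEll2010, Thm 2.1 p.13] -/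
theorem vojtaIneq_conj_cheb {m : ℕ} (hm : 1 ≤ m)
    (hT : ∀ ε : ℝ, 0 < ε → VojtaIneq
      {Q : NFPoint | (∀ τ : Q.F →+* ℂ, A (τ Q.x)) ∧ ∀ τ : Q.F →+* PadicAlgCl p, B (τ Q.x)} d ε) :
    ∀ ε : ℝ, 0 < ε → VojtaIneq
      {P : NFPoint | (∀ σ : P.F →+* ℂ, aeval (σ P.x) (P1FiniteMap.cheb m).den = 0 ∨
          A ((P1FiniteMap.cheb m).eval (σ P.x))) ∧
        ∀ σ : P.F →+* PadicAlgCl p, aeval (σ P.x) (P1FiniteMap.cheb m).den = 0 ∨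
          B ((P1FiniteMap.cheb m).eval (σ P.x))} d ε := by
  obtain ⟨C, hC⟩ := exists_hlow_cheb m
  exact vojtaIneq_conj_of_transfer (P1FiniteMap.chebReduced m hm)
    (by rw [P1FiniteMap.chebReduced_B_deg]; change 2 * m + 1 ≤ 2 * m + 1; exact le_rfl) hC hT

end NFPoint

end Literature.NumberTheory.DiophantineGeometry.GenEll

end
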